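import Literature.AnabelianGeometry.AbsoluteAnabelian.AbsAnabBaseReciprocityTransport
import Literature.NumberTheory.GaloisRepresentations.PadicAlgebraOfLocalField
import Mathlib.LinearAlgebra.SymplecticGroup
import HarnessLib

/-!
# The Jannsen–Wingberg generators of `G_k` read through local class field theory, and the twist
# automorphisms `x_b ↦ x_b x_a`, `x_a ↦ x_a x_b⁻¹` of the presentation (named fact, group level)

U. Jannsen, K. Wingberg, *Die Struktur der absoluten Galoisgruppe 𝔭-adischer Zahlkörper*, Invent. Math. **70**
(1982) 71–98 [JannsenWingberg1982]: Einleitung pp. 71–72 and Theorem 2 p. 75 — for a `p`-adic field `k`, `p ≠ 2`,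
`[k : ℚ_p] = n`, the absolute Galois group `G_k` is the profinite group `F(x_0, …, x_n; 𝔊)/(r)` on generators
`σ, τ, x_0, …, x_n` with (A) the closed normal subgroup generated by `x_0, …, x_n` pro-`p`, (B) `στσ⁻¹ = τ^q`, and (C) ONE
further relation `x_0^σ = (x_0, τ)^g x_1^{p^s} [x_1, x_2][x_3, x_4]⋯[x_{n−1}, x_n]` (`n` even) resp.
`x_0^σ = (x_0, τ)^g x_1^{p^s} [x_1, y_1][x_2, x_3]⋯[x_{n−1}, x_n]` (`n` odd); and §5.1 p. 96 l. 57–60: «Für p-adische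
Zahlkörper `k ≠ ℚ_p` induziert der Automorphismus `ψ` von `F(x_0, …, x_n; 𝔊)` mit `ψ(σ) = σ`, `ψ(τ) = τ`, `ψ(x_i) = x_i`
für `i ≠ n` und `ψ(x_n) = x_n x_{n−1}` direkt einen äußeren Automorphismus von `G_k = F(x_0, …, x_n; 𝔊_q)/(r)`, da
`ψ(r) = r` gilt.»  Restated: J. Neukirch, A. Schmidt, K. Wingberg, *Cohomology of Number Fields* (2008) Thm. 7.5.14 and
the discussion preceding Thm. 7.5.15 [NeukirchSchmidtWingberg2008]; Y. Hoshi, Y. Nishio, Res. Number Theory **8**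
(2022) [HoshiNishio2022OuterAutMLF], Prop. 1.1 (RIMS-1931 p. 4 l. 14–33: topological generators `σ, τ, x_0, …, x_{d(G)}`,
positive integers `s, g, h`, `δ ∈ [G, G]`, «that satisfy the following four conditions» (0)–(3); (1) «The normal closed
subgroup `P(G)` [which is pro-`p(G)` — cf. [4], Proposition 3.6] of `G` is topologically normally generated by
`x_0, …, x_{d(G)}`», (2) «The equality `στσ⁻¹ = τ^{q(G)}` holds, where we write `q(G) := p(G)^{f(G)}`» — the symbol `q(G)` is
Hoshi–Nishio's (p. 4 l. 23); Kondo's Thm. 2.1 (3) writes `τ^{p(G)^{f(G)}}` directly), p. 4 l. 37–43 («`y_i ∈ k_+(G)` for the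
image of `x_i ∈ P(G)` … in `k_+(G)`», «`z_i ∈ O^≺(G)^{ab/tor}` for the image of `x_i ∈ P(G)` … in `O^≺(G)^{ab/tor}`»), the
proof of Lemma 1.3 p. 5 l. 3–12 («`{z_i}_{i∈S}` topologically generates `O^≺(G)^{ab/tor}` (`⊆ G^{ab/tor}`) [cf. [4],
Definition 3.10, (i), (ii)]»; «the relation `1 = z_0^H z_1^{p(G)^s}` in `O^≺(G)^{ab/tor}` holds for some nonzero [cf. the
condition (0) of Proposition 1.1] integer `H`»), p. 5 l. 22–24 (the twist `*α(x_{d(G)}) = x_{d(G)} x_{d(G)−1}`); K. Kondo,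
arXiv:2512.09231 (2025) [Kondo2025OuterAutMLF], Thm. 2.1 ((1) «`G` is presented as the profinite group topologically
generated by `σ`, `τ`, `x_0, …, x_{d(G)} ∈ G` and subject to the relations described in the conditions (3) and (4) below»,
(2)–(4); print's Thm. 2.1 is cited inside Kondo's proofs as «Theorem (generator and relation of group of MLF-type)», normalised
to «Theorem 2.1» in the quotations of this file) and the proof of Thm. 2.3, p. 10 (for `d ≥ 3`, `g := (d−2)/2` (`d` even) resp.
`(d−1)/2` (`d` odd), `a_i := x_{2i+1}`, `b_i := x_{2i+2}` (`d` even) resp. `a_i := x_{2i}`, `b_i := x_{2i+1}` (`d` odd),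
`1 ≤ i ≤ g`: «it follows from Theorem 2.1 that … there exist automorphisms `φ_i, φ'_i` of `G_k`» with `φ_i(b_i) = b_i a_i`,
`φ'_i(a_i) = a_i b_i⁻¹`, all other generators `σ, τ, x_j` fixed).

TYPED HERE (abc-iut cell, seat abc-iut-c312-1 gen 11, row «R12 JW-TWISTS-FROM-PRESENTATION»; GAP-LEDGER row G-c312-1-g9-1
successor) as ONE named fact `JannsenWingbergTwists` at the GROUP LEVEL, in the tree's vocabulary, for an MLF `k` of
characteristic `0` with its standard algebraic closure (`Field.absoluteGaloisGroup k`, Krull topology):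
* the dictionary `O^≺(G_k) := Im(P(G_k) → G_k^{ab}) ≅ O_k^≺` (principal units) — OUR GLOSS (not a quotation) assembled from
  Hoshi–Nishio §0, p. 3 l. 51 «the module `O^≺(G)` is defined to be the image of `P(G) ⊆ G` in `G^{ab}`» and p. 3 l. 44–48
  «there exist functorial isomorphisms `O_k^≺ ⥲ O^≺(G_k)`, `k^× ⥲ k^×(G_k)`, and `k_+ ⥲ k_+(G_k)`» [both cf. Hoshi [4],
  Prop. 3.6, Prop. 3.11 (i), (iv) — the isomorphism being the one induced by the local reciprocity map, [4] Prop. 3.11] — is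
  read through THE canonical reciprocity map of the tree
  (`(isReciprocitySystemE (isClassFieldTheory_localWeilDatum k)).theta : kˣ → G_k^{ab}`, Serre's `θ`, abc-iut layer L4 /
  trunk GalRep): the wild generators `x_j` come with principal units `u_j` such that `[x_j] = θ(u_j)` (these `u_j` are
  Hoshi–Nishio's `z_j`, and `log_k u_j` their `y_j`); condition (1) becomes «`u_0, …, u_d` topologically generate the
  principal units» and relation (3) is recorded through its abelianised consequence «`u_0^H u_1^{p^s}` is torsion, `H ≠ 0`»
  (the sentence of the proof of Lemma 1.3) —
  -- TODO(general form): relation (3)/(C) itself (`(x_0, τ)^g` with `Ẑ`-exponents, Jannsen–Wingberg p. 74) and the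
  -- presentation `G_k ≅ F(x_0, …, x_n; 𝔊)/(r)` as a universal property are NOT typed (no free pro-`𝔊` operator
  -- groups in the tree); only the consequences print draws from them below are.
* the twist automorphisms are recorded as print states them: topological automorphisms of `G_k` fixing `σ, τ` and every
  `x_j` but one, with `φ(x_b) = x_b x_a` resp. `φ'(x_a) = x_a x_b⁻¹`, for every Kondo plane `(a, b)`.  Their existence
  given the presentation is the one-line verification «`ψ(r) = r`» (Jannsen–Wingberg §5.1): the commutator identities
  `[a, b·a] = [a, b]`, `[a·b⁻¹, b] = [a, b]` (proved in the consumer file `Summits/ABC/IUTFork/Thm311RealInd1StripTwistJW.lean`)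
  — the substitutions touch the relation only through one commutator `[x_a, x_b]` with `a, b ≥ 2`.  Published sources give the twist for the last plane `(x_{d−1}, x_d)` and `φ` only (Jannsen–Wingberg,
  NSW, Hoshi–Nishio); ALL planes and `φ'` are Kondo's (a 2025 preprint) — flag (α) of plan/FACT-LIST-PLACEMENT-IUTch.md
  is inherited for exactly that part.
What this fact is FOR: abc-iut-c312-1's `DehnTwistTransvectionsOnUnitsAll` (same directory, p473922) recorded Kondo's
`k_+`-LEVEL statement «`(φ_i)_+` is the elementary transvection `y_b ↦ y_b + y_a` of the basis `y_1, …, y_d`»; from the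
present GROUP-LEVEL fact that statement (Hoshi–Nishio Lemma 1.3 + Kondo's computation of `(φ_i)_+` through THE equivariant
lift / `Art⁻¹ ∘ φ^{ab} ∘ Art` / `log`) is PROVED in the tree at every completion of a number field
(`Summits/ABC/IUTFork/Thm311RealInd1StripTwistJW*.lean`).  A classical result about `G_k`; nothing here bears on
[IUTchIII] Cor. 3.12; no side taken; a named fact is an assumption with a citation; typed ≠ proved.

v3 (same seat, gen 12, row «R14 FIRST-PLANE TWIST»; append-only, the two v1 declarations byte-identical; module docstring:
quote hygiene of referee k's cluster K32-n1 applied — the `O^≺` dictionary re-badged as a gloss, dropped words of the Thm. 2.1 (1)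
and Lemma 1.3 quotations restored, `q(G)` attributed): `JWTwist` (ONE twist `x_b ↦ x_b x_a`, the `φ`-half of `JWTwistPair`) and
the named fact **`JannsenWingbergTwistsFirst`** — for EVEN `d = [k : ℚ_p] ≥ 2`, the v1 data and clauses TOGETHER WITH the twist on
the FIRST pair `(x_1, x_2)`: `φ(σ) = σ`, `φ(τ) = τ`, `φ(x_2) = x_2 x_1`, `φ(x_j) = x_j` (`j ≠ 2`).  Print: for `d = 2` this is
Jannsen–Wingberg's `ψ` of §5.1 p. 96 with `n = 2` (`ψ(x_n) = x_n x_{n−1}`, `k ≠ ℚ_p`) = Hoshi–Nishio's `*α` at `d(G) = 2`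
(p. 5 l. 22–24: «let `*α` be an automorphism of `G` as in the discussion preceding [7], Theorem 7.5.15, i.e., defined by the
equalities `*α(σ) = σ`, `*α(τ) = τ`, `*α(x_{d(G)}) = x_{d(G)} x_{d(G)−1}`, and `*α(x_i) = x_i` for `i ∈ S∖{d(G)}`»; Thm. 1.5
p. 5 l. 25–31) = Kondo's `φ` in the proof of Thm. 2.3, case `d_k = 2` (arXiv:2512.09231 p. 10: «it follows from Theorem 2.1 that
there exists an element `φ ∈ Aut(G_k)` satisfying the following equalities: `φ(σ)=σ`, `φ(τ)=τ`, `φ(x_0)=x_0`, `φ(x_1)=x_1`,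
`φ(x_2)=x_2x_1`»); for even `d ≥ 4` the same `φ` ALONGSIDE the plane twists is Kondo's Lemma 2.5 («Suppose that `p_k` is odd, and
that `d_k` is even. Let `φ` be the automorphism of `G_k` defined by the following equalities [cf. Theorem 2.1]: `φ(σ)=σ`, `φ(τ)=τ`,
`φ(x_2)=x_2x_1`, `φ(x_i)=x_i` (`i ≠ 2`)») and the last paragraph of the proof of Thm. 2.3, even case («Let `φ` denote the
automorphism of `G_k` defined similarly to “`φ`” that appears in the proof of the case `d_k = 2`») — a 2025 preprint: flag (α)
inherited for `d ≥ 4` exactly as for v1's planes.  In the relation (C)/(4) for even `d` the pair `[x_1, x_2]` IS a commutator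
factor and `x_1` is fixed by `φ`, so «`ψ(r) = r`» is again the identity `[a, b·a] = [a, b]`; the partner `x_1 ↦ x_1 x_2⁻¹` is NOT
recorded (it would move the factor `x_1^{p^s}`; no source states it).  What v3 is FOR: Kondo's Thm. 2.3 for EVEN `d`
(`Ker(Tr_{k/ℚ_p}) = ⟨y_1, y_3, …, y_d⟩`, whose proof uses this `φ` to get `y_1 ∈ Ker Tr`) and the quadratic case `d = 2` of the
(Ind1)-strip statements of record of abc-iut-c312-1 (consumers `Summits/ABC/IUTFork/Thm311RealInd1StripTwistJWFirst*.lean`).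
[cite: JannsenWingberg1982, §5.1 p.96] [cite: HoshiNishio2022OuterAutMLF, §1 p.5 l.22–31 (definition of *α, Thm 1.5)]
[cite: Kondo2025OuterAutMLF, §2 Lemma 2.5 and proof of Thm 2.3 p.10]
-/

noncomputable section

namespace Literature.AnabelianGeometry.AbsoluteAnabelian

open Field ValuativeRel
open Literature.NumberTheory.GaloisRepresentations Literature.NumberTheory.GaloisRepresentations.LocalWeilDatum
open scoped ValuativeRel

/-! ## The named fact -/

/-- **A Jannsen–Wingberg twist pair on the plane `(x_a, x_b)`** (Kondo, proof of Thm. 2.3 p. 10: `φ_i(b_i) = b_i a_i`,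
`φ'_i(a_i) = a_i b_i⁻¹`, `φ_i, φ'_i` fixing `σ, τ` and every other `x_j`, `j ≤ d`; Jannsen–Wingberg §5.1 p. 96 and
Hoshi–Nishio p. 5 l. 22–24 for `(a, b) = (d−1, d)` and `φ`): two topological automorphisms of `G` with these values on
the generators `σ, τ, x_0, …, x_d`. [cite: Kondo2025OuterAutMLF, §2 proof of Thm 2.3 p.10]
[cite: JannsenWingberg1982, §5.1 p.96] -/
def JWTwistPair {G : Type*} [Group G] [TopologicalSpace G] (σ τ : G) (x : ℕ → G) (d a b : ℕ) : Prop :=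
  (∃ φ : G ≃ₜ* G, φ σ = σ ∧ φ τ = τ ∧ (∀ j ≤ d, j ≠ b → φ (x j) = x j) ∧ φ (x b) = x b * x a) ∧
  (∃ φ' : G ≃ₜ* G, φ' σ = σ ∧ φ' τ = τ ∧ (∀ j ≤ d, j ≠ a → φ' (x j) = x j) ∧ φ' (x a) = x a * (x b)⁻¹)

/-- **Jannsen–Wingberg generators of `G_k`, read through the reciprocity map, with the twist automorphisms.**
For an MLF `k` of characteristic `0` with ODD residue characteristic `p` and `d := [k : ℚ_p] ≥ 2` (Hoshi–Nishio §1: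
`p(G)` odd, `d(G) > 1`), `G_k = Gal(k̄/k)` its absolute Galois group (standard closure, Krull topology) and
`θ : kˣ → G_k^{ab}` THE local reciprocity map: there are `σ, τ, x_0, …, x_d ∈ G_k`, principal units `u_0, …, u_d ∈ 𝒪_k^×` (`|u_j − 1| < 1`),
a positive integer `s` and a nonzero integer `H` such that
* `σ, τ, x_0, …, x_d` topologically generate `G_k` (Hoshi–Nishio Prop. 1.1; Kondo Thm. 2.1 (1));
* `στσ⁻¹ = τ^q`, `q = #𝓀_k` (Jannsen–Wingberg (B); Hoshi–Nishio (2); Kondo (3));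
* `[x_j] = θ(u_j)` in `G_k^{ab}` for `j ≤ d` — the `x_j` lie in the wild inertia `P(G_k)`, whose image in `G_k^{ab}` is
  `O^≺(G_k) ≅ 𝒪_k^≺` (Hoshi–Nishio p. 4 l. 37–43 `z_j`, p. 3 l. 39–51; Kondo p. 9 l. 37–38 `P(G) ↪ I(G) → 𝒪^×(G)`);
* the `u_j` topologically generate the principal units (Hoshi–Nishio (1) «`P(G)` is topologically normally generated by
  `x_0, …, x_{d(G)}`» read in `G_k^{ab} ⊇ O^≺(G_k) ≅ 𝒪_k^≺`; proof of Lemma 1.3 p. 5 l. 3–6);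
* `u_0^H · u_1^{p^s}` is torsion (the abelianised relation (3): «`1 = z_0^H z_1^{p(G)^s}` in `O^≺(G)^{ab/tor}` … for
  some nonzero integer `H`», proof of Lemma 1.3 p. 5 l. 8–12);
* for every Kondo plane — `(x_{2i+1}, x_{2i+2})`, `1 ≤ i ≤ (d−2)/2`, if `d` is even; `(x_{2i}, x_{2i+1})`, `1 ≤ i ≤ (d−1)/2`,
  if `d` is odd — the twist pair `JWTwistPair` (Kondo, proof of Thm. 2.3 p. 10; Jannsen–Wingberg §5.1 p. 96 l. 57–60).
-- TODO(general form): the presentation `G_k ≅ F(x_0, …, x_d; 𝔊)/(r)` (Jannsen–Wingberg Thm. 2) and relation (C)/(3)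
-- verbatim are not typed; see the module docstring.
[cite: JannsenWingberg1982, Thm 2 p.75 and §5.1 p.96] [cite: NeukirchSchmidtWingberg2008, Thm 7.5.14]
[cite: HoshiNishio2022OuterAutMLF, Prop 1.1 and proof of Lemma 1.3 p.5] [cite: Kondo2025OuterAutMLF, §2 Thm 2.1 and proof of Thm 2.3 p.10] -/
def JannsenWingbergTwists : Prop :=
  ∀ (k : Type) [Field k] [ValuativeRel k] [TopologicalSpace k] [IsNonarchimedeanLocalField k] [CharZero k]
    (p : ℕ) [Fact p.Prime] (hp : valuation k p < 1), p ≠ 2 →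
    letI : Algebra ℚ_[p] k := LocalField.padicAlgebra k p hp
    haveI : ValuativeExtension k k := ⟨fun _ _ => Iff.rfl⟩
    2 ≤ Module.finrank ℚ_[p] k →
      ∃ (σ τ : absoluteGaloisGroup k) (x : ℕ → absoluteGaloisGroup k) (u : ℕ → kˣ) (s : ℕ) (H : ℤ),
        -- topological generation of `G_k` by `σ, τ, x_0, …, x_d`
        (Subgroup.closure ({σ, τ} ∪ x '' Set.Iic (Module.finrank ℚ_[p] k))).topologicalClosure = ⊤ ∧
        -- the tame relation
        σ * τ * σ⁻¹ = τ ^ Nat.card 𝓀[k] ∧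
        -- the wild generators read through `θ`: `[x_j] = θ(u_j)`, `u_j` a principal unit
        (∀ j ≤ Module.finrank ℚ_[p] k,
          valuation k ((u j : k) - 1) < 1 ∧
          absGaloisAbProj k (x j) =
            (isReciprocitySystemE (F := k) (E := k) (isClassFieldTheory_localWeilDatum k)).theta (u j)) ∧
        -- the `u_j` topologically generate the principal units `{w : |w - 1| < 1}` (closure in `kˣ`)
        (∀ w : kˣ, valuation k ((w : k) - 1) < 1 →
          w ∈ (Subgroup.closure (u '' Set.Iic (Module.finrank ℚ_[p] k))).topologicalClosure) ∧
        -- the abelianised relation: `u_0^H u_1^{p^s}` is torsion, `s > 0`, `H ≠ 0`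
        0 < s ∧ H ≠ 0 ∧ IsOfFinOrder (u 0 ^ H * u 1 ^ (p ^ s)) ∧
        -- the twists on Kondo's planes
        (Even (Module.finrank ℚ_[p] k) → ∀ i, 1 ≤ i → 2 * i + 2 ≤ Module.finrank ℚ_[p] k →
          JWTwistPair σ τ x (Module.finrank ℚ_[p] k) (2 * i + 1) (2 * i + 2)) ∧
        (Odd (Module.finrank ℚ_[p] k) → ∀ i, 1 ≤ i → 2 * i + 1 ≤ Module.finrank ℚ_[p] k →
          JWTwistPair σ τ x (Module.finrank ℚ_[p] k) (2 * i) (2 * i + 1))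

/-! ## Note on the exponents in the abelianised relation (same seat, same session; comment only)

The clause `0 < s ∧ H ≠ 0 ∧ IsOfFinOrder (u 0 ^ H * u 1 ^ (p ^ s))` types Hoshi–Nishio's sentence (proof of Lemma 1.3,
RIMS-1931 p. 5 l. 8–12) «the relation `1 = z_0^H z_1^{p(G)^s}` in `O^≺(G)^{ab/tor}` holds for some nonzero [cf. the condition (0)]
integer `H`» with `H ∈ ℤ` and the exponent of `z_1` equal to `p^s`.  How it comes out of relation (3) of their Prop. 1.1
(`σx_0σ⁻¹ = (x_0^{h^{p−1}} τ ⋯ x_0^h τ)^{πg/(p−1)} x_1^{p^s} δ`, `g, h` positive integers, `π ∈ Ẑ` the idempotent of `ℤ_p`):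
in the torsion-free `ℤ_p`-module `O^≺(G)^{ab/tor}` (additively; `τ ↦ 0` by (2), `δ ↦ 0`, conjugation by `σ` trivial) it reads
`(1 − gΣ/(p−1))·z_0 = p^s·z_1`, `Σ := h + h² + ⋯ + h^{p−1}`, and condition (0) is `gΣ ≠ p − 1`.  If `(p − 1) ∣ gΣ` this is
literally the clause (`H := gΣ/(p−1) − 1 ∈ ℤ ∖ {0}`).  In general one uses the freedom in the datum `g`: Jannsen–Wingberg's
Theorem 2 (p. 75) holds for EVERY lift `β : 𝔊 → ℤ_p^×` of the character `α⁻¹` («eine Liftung von `α⁻¹` (als Abbildung)»), and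
`g = β(σ)` is determined only modulo `p^s`; replacing `g` by `g + k p^s` (still a positive integer `> p`, as Hoshi–Nishio
require) changes `gΣ` by `k p^s Σ`, and since `gcd(p^s Σ, p − 1) = gcd(Σ, p − 1)` divides `gΣ`, some `k` achieves
`(p − 1) ∣ (g + kp^s)Σ` together with `(g + kp^s)Σ ≠ p − 1`.  Hence SOME system of Jannsen–Wingberg generators satisfies the
clause as typed (the fact is existential in `σ, τ, x, u, s, H`).  A reader who prefers not to use this freedom may read the clause
as the weaker `∃ H N ∈ ℤ, H ≠ 0, u_0^H · u_1^N ∈ μ(k)` (exponents `(p−1) − gΣ` and `−(p−1)p^s`), which is all the consumers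
use (`Summit.ABC.IUTFork.Thm311.Real.dehnTwists_closureAt_of_jannsenWingberg` needs only `y_0 ∈ ℚ_p·y_1`).
[cite: HoshiNishio2022OuterAutMLF, proof of Lemma 1.3 p.5] [cite: JannsenWingberg1982, Thm 2 p.75] -/

/-! ## v3: the twist on the FIRST pair `(x_1, x_2)` for even degree (Jannsen–Wingberg §5.1 with `n = 2`;
Hoshi–Nishio's `*α` at `d(G) = 2`; Kondo's `φ` of Lemma 2.5 / proof of Thm. 2.3) -/

/-- **One Jannsen–Wingberg twist on the pair `(x_a, x_b)`**: a topological automorphism `φ` of `G` with `φ(σ) = σ`, `φ(τ) = τ`,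
`φ(x_j) = x_j` for `j ≤ d`, `j ≠ b`, and `φ(x_b) = x_b x_a` — the `φ`-half of `JWTwistPair` (Hoshi–Nishio p. 5 l. 22–24:
«`*α(σ) = σ`, `*α(τ) = τ`, `*α(x_{d(G)}) = x_{d(G)} x_{d(G)−1}`, and `*α(x_i) = x_i` for `i ∈ S∖{d(G)}`» is the case
`(a, b) = (d(G)−1, d(G))`; Kondo, proof of Thm. 2.3 p. 10, `φ_i(b_i) = b_i a_i`). [cite: HoshiNishio2022OuterAutMLF, §1 p.5 l.22–24]
[cite: Kondo2025OuterAutMLF, §2 proof of Thm 2.3 p.10] -/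
def JWTwist {G : Type*} [Group G] [TopologicalSpace G] (σ τ : G) (x : ℕ → G) (d a b : ℕ) : Prop :=
  ∃ φ : G ≃ₜ* G, φ σ = σ ∧ φ τ = τ ∧ (∀ j ≤ d, j ≠ b → φ (x j) = x j) ∧ φ (x b) = x b * x a

/-- **Jannsen–Wingberg generators of `G_k` read through the reciprocity map, with the plane twists AND the twist on the first pair
`(x_1, x_2)` — EVEN degree.**  For an MLF `k` of characteristic `0` with ODD residue characteristic `p` and EVEN
`d := [k : ℚ_p] ≥ 2`: there are `σ, τ, x_0, …, x_d ∈ G_k`, principal units `u_0, …, u_d`, a positive integer `s` and a nonzero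
integer `H` satisfying the five clauses of `JannsenWingbergTwists` verbatim (topological generation of `G_k`; `στσ⁻¹ = τ^q`;
`[x_j] = θ(u_j)`; the `u_j` topologically generate the principal units; `u_0^H u_1^{p^s}` torsion), the twist pairs `JWTwistPair`
on Kondo's planes `(x_{2i+1}, x_{2i+2})`, `1 ≤ i ≤ (d−2)/2` (as in v1), AND `JWTwist σ τ x d 1 2`: a topological automorphism `φ`
of `G_k` with `φ(σ) = σ`, `φ(τ) = τ`, `φ(x_j) = x_j` (`j ≤ d`, `j ≠ 2`), `φ(x_2) = x_2 x_1`.  For `d = 2` (no planes) the last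
clause is Jannsen–Wingberg §5.1 p. 96 with `n = 2` («`ψ(x_i) = x_i` für `i ≠ n` und `ψ(x_n) = x_n x_{n−1}` … da `ψ(r) = r`
gilt», `k ≠ ℚ_p`) = Hoshi–Nishio's `*α` at `d(G) = 2` (p. 5 l. 22–24; Thm. 1.5) = Kondo's `φ` in the proof of Thm. 2.3, case
`d_k = 2` (p. 10: «there exists an element `φ ∈ Aut(G_k)` satisfying … `φ(σ)=σ`, `φ(τ)=τ`, `φ(x_0)=x_0`, `φ(x_1)=x_1`,
`φ(x_2)=x_2x_1`»); for even `d ≥ 4`, `φ` together with the plane twists of ONE generator system is Kondo's Lemma 2.5 («Let `φ`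
be the automorphism of `G_k` defined by the following equalities [cf. Theorem 2.1]: `φ(σ)=σ`, `φ(τ)=τ`, `φ(x_2)=x_2x_1`,
`φ(x_i)=x_i` (`i ≠ 2`)») with the last paragraph of the proof of Thm. 2.3 (even case) — a 2025 preprint, flag (α) of
plan/FACT-LIST-PLACEMENT-IUTch.md inherited for that part, as in v1.  The partner twist `x_1 ↦ x_1 x_2⁻¹` is NOT asserted (no
source; it would not fix the relation's factor `x_1^{p^s}`).
-- TODO(general form): as for `JannsenWingbergTwists` — the presentation `G_k ≅ F(x_0, …, x_d; 𝔊)/(r)` (Jannsen–Wingberg Thm. 2)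
-- and relation (C)/(3) verbatim are not typed; only the consequences print draws from them are.
[cite: JannsenWingberg1982, Thm 2 p.75 and §5.1 p.96] [cite: NeukirchSchmidtWingberg2008, Thm 7.5.14]
[cite: HoshiNishio2022OuterAutMLF, Prop 1.1, proof of Lemma 1.3 p.5, p.5 l.22–31 (definition of *α, Thm 1.5)]
[cite: Kondo2025OuterAutMLF, §2 Thm 2.1, Lemma 2.5 and proof of Thm 2.3 p.10] -/
def JannsenWingbergTwistsFirst : Prop :=
  ∀ (k : Type) [Field k] [ValuativeRel k] [TopologicalSpace k] [IsNonarchimedeanLocalField k] [CharZero k]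
    (p : ℕ) [Fact p.Prime] (hp : valuation k p < 1), p ≠ 2 →
    letI : Algebra ℚ_[p] k := LocalField.padicAlgebra k p hp
    haveI : ValuativeExtension k k := ⟨fun _ _ => Iff.rfl⟩
    2 ≤ Module.finrank ℚ_[p] k → Even (Module.finrank ℚ_[p] k) →
      ∃ (σ τ : absoluteGaloisGroup k) (x : ℕ → absoluteGaloisGroup k) (u : ℕ → kˣ) (s : ℕ) (H : ℤ),
        -- topological generation of `G_k` by `σ, τ, x_0, …, x_d`
        (Subgroup.closure ({σ, τ} ∪ x '' Set.Iic (Module.finrank ℚ_[p] k))).topologicalClosure = ⊤ ∧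
        -- the tame relation
        σ * τ * σ⁻¹ = τ ^ Nat.card 𝓀[k] ∧
        -- the wild generators read through `θ`: `[x_j] = θ(u_j)`, `u_j` a principal unit
        (∀ j ≤ Module.finrank ℚ_[p] k,
          valuation k ((u j : k) - 1) < 1 ∧
          absGaloisAbProj k (x j) =
            (isReciprocitySystemE (F := k) (E := k) (isClassFieldTheory_localWeilDatum k)).theta (u j)) ∧
        -- the `u_j` topologically generate the principal units `{w : |w - 1| < 1}` (closure in `kˣ`)
        (∀ w : kˣ, valuation k ((w : k) - 1) < 1 →
          w ∈ (Subgroup.closure (u '' Set.Iic (Module.finrank ℚ_[p] k))).topologicalClosure) ∧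
        -- the abelianised relation: `u_0^H u_1^{p^s}` is torsion, `s > 0`, `H ≠ 0`
        0 < s ∧ H ≠ 0 ∧ IsOfFinOrder (u 0 ^ H * u 1 ^ (p ^ s)) ∧
        -- the twists on Kondo's planes `(x_{2i+1}, x_{2i+2})`, `1 ≤ i`, `2i + 2 ≤ d` (even `d`)
        (∀ i, 1 ≤ i → 2 * i + 2 ≤ Module.finrank ℚ_[p] k →
          JWTwistPair σ τ x (Module.finrank ℚ_[p] k) (2 * i + 1) (2 * i + 2)) ∧
        -- the twist on the FIRST pair `(x_1, x_2)`: `φ(x_2) = x_2 x_1`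
        JWTwist σ τ x (Module.finrank ℚ_[p] k) 1 2

/-! ## v4: the MAPPING-CLASS-GROUP part of `Aut(G_k)` — every `A ∈ Sp_{2g}(ℤ)` is the abelianised plane action of an automorphism of `G_k`
fixing `σ, τ, x_0, x_1` (Kondo §3: Thm. 3.17 / Rem. 3.18, over Farb–Margalit Thm. 6.4), ODD degree `d = 1 + 2g ≥ 3` -/

/-- **Jannsen–Wingberg generators of `G_k` read through the reciprocity map, with the plane twists AND the mapping-class-group image —
ODD degree.**  For an MLF `k` of characteristic `0` with ODD residue characteristic `p` and ODD `d := [k : ℚ_p] = 1 + 2g ≥ 3`: there are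
`σ, τ, x_0, …, x_d ∈ G_k`, principal units `u_0, …, u_d`, `s > 0`, `H ≠ 0` satisfying the five clauses of `JannsenWingbergTwists` verbatim
(topological generation; `στσ⁻¹ = τ^q`; `[x_j] = θ(u_j)`; the `u_j` topologically generate the principal units; `u_0^H u_1^{p^s}` torsion) and
the plane twist pairs `JWTwistPair` on Kondo's planes `(x_{2i}, x_{2i+1})`, `1 ≤ i ≤ g` (as in v1, odd case), AND: indexing the plane generators
by `Fin g ⊕ Fin g` (`inl i ↦ a_{i+1} = x_{2i+2}`, `inr i ↦ b_{i+1} = x_{2i+3}`; Kondo p. 18 l. 22–38: «`a_i ↦ x_{2i}`, `b_i ↦ x_{2i+1}` (if `d_k` is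
odd)»), for EVERY integer symplectic matrix `A ∈ Sp_{2g}(ℤ)` (Mathlib `Matrix.symplecticGroup (Fin g) ℤ`) there is a topological automorphism `φ`
of `G_k` with `φ(σ) = σ`, `φ(τ) = τ`, `φ(x_0) = x_0`, `φ(x_1) = x_1` whose action on the abelianised plane generators is `A`:
`[φ(x_c)] = Π_r [x_r]^{A_{r c}}` in `G_k^{ab}` for every plane index `c`.  PRINT (K. Kondo, arXiv:2512.09231 §3, for `d_k ≥ 3` odd, `p_k` odd — a
2025 PREPRINT, flag (α) of plan/FACT-LIST-PLACEMENT-IUTch.md inherited): p. 18 l. 40–61 «It follows from Theorem (generator and relation of group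
of MLF-type) that, under this assignment, automorphism `φ` of `π₁(S∖{P})` that fixes `δ` induces an automorphism of `G_k` … If `d_k` is odd, then
`φ(σ) = σ`, `φ(τ) = τ`, `φ(x_0) = x_0`, `φ(x_1) = x_1`», «there exists a lifting in `Aut(π₁(S∖{P}))` of the image of each element of `Mod(S∖{P})`
which fixes `δ` [cf. [16], Theorem 4.1]»; Thm. 3.17 (p. 18 l. 87–100, from Farb–Margalit, *A Primer on Mapping Class Groups*, PMS 49, Thm. 6.4 p. 147
l. 23 «The representation `Ψ : Mod(S_g) → Sp(2g, ℤ)` is surjective for `g ≥ 1`»): «Consider the representation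
`Mod(S∖{P}) → Out(π₁(S∖{P})) → Aut(π₁(S∖{P})^{ab}) ≅ GL_{2g}(ℤ)` … Then the image of this map is `Sp_{2g}(ℤ)`»; Rem. 3.18 (p. 19 l. 12–25):
«it follows from the definitions of the mono-anabelian reconstruction algorithm and of `ρ` that the following diagram commutes» (`Φ ∘ ρ` = the
symplectic representation, `Sp_{2g}(ℤ) ⊂ GL_{d_k}(ℚ_{p_k})` by `A ↦ diag(1, A)`).  The abelianised form recorded here («`[φ(x_c)] = Π_r [x_r]^{A_{rc}}`»)
is what «induces … under this assignment» and the commutative diagram say at the level of `G_k^{ab}`; Kondo's `ρ` is a map of SETS into `Out(G_k)`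
(«not necessarily a homomorphism», Rem. 3.18) — nothing here asserts a homomorphism `Mod → Out(G_k)`, only, for each `A`, the existence of ONE
automorphism; the EVEN-degree analogue (assignment `a_i ↦ x_{2i+1}`, `b_i ↦ x_{2i+2}`, `φ(x_2) = x_2` too) carries no printed Sp-image sentence and is
NOT asserted.  `Sp_{2g}(ℤ)` being closed under transpose and inverse, the row/column convention of `A` is immaterial.
-- TODO(general form): as for `JannsenWingbergTwists` — the presentation itself and relation (C)/(3) verbatim are not typed; Kondo's closed
-- subgroup `D ⊆ Out(G_k)` and «`Φ(D) = Sp_{2g}(ℤ_{p_k})`» (proof of Thm. 3.19, p. 19 l. 52–55) are the topological closure of what is recorded.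
[cite: Kondo2025OuterAutMLF, §3 p.18 l.40–61, Thm 3.17 p.18 l.87–100, Rem 3.18 p.19 l.12–25] [cite: FarbMargalit2012, Thm 6.4 p.147]
[cite: JannsenWingberg1982, Thm 2 p.75 and §5.1 p.96] [cite: HoshiNishio2022OuterAutMLF, Prop 1.1 and proof of Lemma 1.3 p.5] -/
def JannsenWingbergMappingClass : Prop :=
  ∀ (k : Type) [Field k] [ValuativeRel k] [TopologicalSpace k] [IsNonarchimedeanLocalField k] [CharZero k]
    (p : ℕ) [Fact p.Prime] (hp : valuation k p < 1), p ≠ 2 →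
    letI : Algebra ℚ_[p] k := LocalField.padicAlgebra k p hp
    haveI : ValuativeExtension k k := ⟨fun _ _ => Iff.rfl⟩
    ∀ g : ℕ, 1 ≤ g → Module.finrank ℚ_[p] k = 1 + 2 * g →
      ∃ (σ τ : absoluteGaloisGroup k) (x : ℕ → absoluteGaloisGroup k) (u : ℕ → kˣ) (s : ℕ) (H : ℤ),
        -- topological generation of `G_k` by `σ, τ, x_0, …, x_d`
        (Subgroup.closure ({σ, τ} ∪ x '' Set.Iic (Module.finrank ℚ_[p] k))).topologicalClosure = ⊤ ∧
        -- the tame relation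
        σ * τ * σ⁻¹ = τ ^ Nat.card 𝓀[k] ∧
        -- the wild generators read through `θ`: `[x_j] = θ(u_j)`, `u_j` a principal unit
        (∀ j ≤ Module.finrank ℚ_[p] k,
          valuation k ((u j : k) - 1) < 1 ∧
          absGaloisAbProj k (x j) =
            (isReciprocitySystemE (F := k) (E := k) (isClassFieldTheory_localWeilDatum k)).theta (u j)) ∧
        -- the `u_j` topologically generate the principal units `{w : |w - 1| < 1}` (closure in `kˣ`)
        (∀ w : kˣ, valuation k ((w : k) - 1) < 1 →
          w ∈ (Subgroup.closure (u '' Set.Iic (Module.finrank ℚ_[p] k))).topologicalClosure) ∧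
        -- the abelianised relation: `u_0^H u_1^{p^s}` is torsion, `s > 0`, `H ≠ 0`
        0 < s ∧ H ≠ 0 ∧ IsOfFinOrder (u 0 ^ H * u 1 ^ (p ^ s)) ∧
        -- the twists on Kondo's planes `(x_{2i}, x_{2i+1})`, `1 ≤ i`, `2i + 1 ≤ d` (odd `d`)
        (∀ i, 1 ≤ i → 2 * i + 1 ≤ Module.finrank ℚ_[p] k →
          JWTwistPair σ τ x (Module.finrank ℚ_[p] k) (2 * i) (2 * i + 1)) ∧
        -- the mapping-class-group image: every `A ∈ Sp_{2g}(ℤ)` is the abelianised plane action of some `φ ∈ Aut(G_k)`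
        -- fixing `σ, τ, x_0, x_1` (plane generators `inl i ↦ x_{2i+2}`, `inr i ↦ x_{2i+3}`, `i : Fin g`)
        ∀ A : Matrix (Fin g ⊕ Fin g) (Fin g ⊕ Fin g) ℤ, A ∈ Matrix.symplecticGroup (Fin g) ℤ →
          ∃ φ : absoluteGaloisGroup k ≃ₜ* absoluteGaloisGroup k,
            φ σ = σ ∧ φ τ = τ ∧ φ (x 0) = x 0 ∧ φ (x 1) = x 1 ∧
            ∀ c : Fin g ⊕ Fin g,
              absGaloisAbProj k (φ (x (Sum.elim (fun i : Fin g => 2 * (i : ℕ) + 2) (fun i : Fin g => 2 * (i : ℕ) + 3) c))) =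
                ∏ r : Fin g ⊕ Fin g,
                  absGaloisAbProj k (x (Sum.elim (fun i : Fin g => 2 * (i : ℕ) + 2) (fun i : Fin g => 2 * (i : ℕ) + 3) r)) ^ A r c

end Literature.AnabelianGeometry.AbsoluteAnabelian

end
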